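/-
Copyright (c) 2026 The decomp-a2c cell. All rights reserved.
Released under Apache 2.0 license as described in the file LICENSE.
-/
import Summits.AtomisticToContinuum.Crystallization.Theorems.ChartedZeroExcessLayeredLatticeLiouvilleWG

/-!
# ChartedZeroExcessLayeredLatticeLiouville — part WH «ColumnMaster»: the master inequality for one vertical increment of one column
  (decomp-a2c-lens-2, g58; helper of stmt-AtomisticToContinuum-26636, leaf (LD′) `ModalLipschitzZ`; brick (4a) `ModalLipschitzAt`, vertical half
  (4a⊥), step (SG) of memo NODE-g58c — the deterministic per-column skeleton of the single-gap estimate)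

For a field `ψ` on the indexed lattice, a column `γ`, a gap `k₀` and a window half-width `R`, write `W = [k₀ − R, k₀ + R]`, `r' = ⌊ϱ/c⌋`,
`Δ(k) = ψ γ (k+1) − ψ γ k`, `h(m) = chainFlux T_F (ψ γ) m` (VO's chain flux of the column profile), `DIV(m) = colFlux T_F ψ γ m − colFlux T_F ψ γ (m−1)`
(WC's column flux) for any index set `T_F` containing the `(r'+1)`-bands of the layers of `W`.  Then (★★★ `increment_le_master`)

  `‖Δ(k₀)‖ ≤ modeConst·( (#W)⁻¹·Σ_{m ∈ W} ‖h(m)‖ + 2·P + Σ_{m ∈ W} ‖DIV(m)‖ + stabConst·(R+2)⁻²·D )`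

whenever `‖colPlanar T_F ψ γ m‖ ≤ P` on `W` and `‖Δ(k)‖ ≤ D` on the collar `[k₀ − R − r', k₀ + R + r'] \ W` — WB's local window stability
`increment_le_local` (coercivity + tail certificate, `ε < 2κ₀`), whose flux datum `blockApply (fluxBlock) T_B Δ` IS the chain flux `h` on the window
(`blockApply_fluxBlock_eq_chainFlux`: VP block form, the blocks vanish off the `r'`-band), and whose size on the window is controlled by TELESCOPING the
column flux along the window (WG `card_mul_norm_le_sum`) and splitting off the planar part (WC `colFlux_eq_chainFlux_add`): `chainFlux_window_bound`.
The squared form `increment_sq_le_master` (Cauchy–Schwarz in the window) is what step (SG) sums over the columns of a planar box: its four terms are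
(B) WG `sum_chainFlux_sq_le`, (C) WG `norm_colPlanar_le` with WA's Lipschitz bound, (A) WF `sum_colFluxDiv_sq_le_energy`, and the crude collar term.
NO harmonicity is used in this part; everything is uniform in `ϱ`, `T_F`, the window and the stacking word.
-/

namespace Summit.AtomisticToContinuum.Crystallization.Theorems.ChartedZeroExcessLayeredLatticeLiouville

open Summit.AtomisticToContinuum.Crystallization.Theorems.ChartedPlanarOrderRigidityDoor (E3)
open Finset
open scoped InnerProductSpace RealInnerProductSpace BigOperators

noncomputable section ColumnMaster

variable {c : ℝ} {a b : E3} {w : ℤ → E3}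

/-! ### WH.1  The block form on a long index set is the chain flux -/

/-- On an index set `T_B` containing the `r'`-band of the layer `n`, the block form `blockApply (fluxBlock) T_B` of the increments of a column profile `cf`
IS the chain flux of `cf` at `n` (for any `T_F` containing the `(r'+1)`-band): the blocks vanish off the band (VP `fluxBlock_eq_zero_of_not_mem`) and VP
`chainFlux_eq_sum_fluxBlock`. [this file, g58] -/
theorem blockApply_fluxBlock_eq_chainFlux (hc : 0 < c) (hL : IsLayeredCrystal c a b w) {ϱ : ℝ} (cf : ℤ → E3) {T_B T_F : Finset ℤ} {n : ℤ}
    (hB : Icc (n - ⌊ϱ / c⌋₊) (n + ⌊ϱ / c⌋₊) ⊆ T_B) (hF : Icc (n - ⌊ϱ / c⌋₊) (n + 1 + ⌊ϱ / c⌋₊) ⊆ T_F) :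
    blockApply (fluxBlock hc hL ϱ) T_B (fun k => cf (k + 1) - cf k) n = chainFlux ϱ a b w T_F cf n := by
  rw [blockApply_split _ hB, sum_eq_zero fun k hk => ?_, add_zero, chainFlux_eq_sum_fluxBlock hc hL cf hF]
  · rfl
  · rw [fluxBlock_eq_zero_of_not_mem hc hL ϱ (mem_sdiff.mp hk).2, zero_apply]

/-! ### WH.2  The flux datum on the window: average + planar part + divergence -/

/-- ★ THE CHAIN FLUX ON A WINDOW by telescoping the column flux: for `m ∈ W = [lo, hi]` and `‖colPlanar T ψ γ k‖ ≤ P` on `W`,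
`‖chainFlux T (ψ γ) m‖ ≤ (#W)⁻¹·Σ_{k ∈ W} ‖chainFlux T (ψ γ) k‖ + 2·P + Σ_{k ∈ W} ‖colFlux T ψ γ k − colFlux T ψ γ (k−1)‖`
(WC `colFlux_eq_chainFlux_add`, WG `card_mul_norm_le_sum`). [this file, g58] -/
theorem chainFlux_window_bound (hc : 0 < c) (hL : IsLayeredCrystal c a b w) (ϱ : ℝ) (T : Finset ℤ) (ψ : Cell 2 → ℤ → E3) (γ : Cell 2)
    {lo hi m : ℤ} (hm : m ∈ Icc lo hi) {P : ℝ} (hP : ∀ k ∈ Icc lo hi, ‖colPlanar ϱ a b w T ψ γ k‖ ≤ P) :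
    ‖chainFlux ϱ a b w T (ψ γ) m‖ ≤ (#(Icc lo hi) : ℝ)⁻¹ * (∑ k ∈ Icc lo hi, ‖chainFlux ϱ a b w T (ψ γ) k‖) + 2 * P +
      ∑ k ∈ Icc lo hi, ‖colFlux ϱ a b w T ψ γ k - colFlux ϱ a b w T ψ γ (k - 1)‖ := by
  have hcf : ∀ k, colFlux ϱ a b w T ψ γ k = chainFlux ϱ a b w T (ψ γ) k + colPlanar ϱ a b w T ψ γ k := colFlux_eq_chainFlux_add hc hL ϱ T ψ γ
  have hN : (0 : ℝ) < #(Icc lo hi) := by exact_mod_cast card_pos.mpr ⟨m, hm⟩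
  have h1 := card_mul_norm_le_sum (fun k => colFlux ϱ a b w T ψ γ k) hm
  have h2 : ‖chainFlux ϱ a b w T (ψ γ) m‖ ≤ ‖colFlux ϱ a b w T ψ γ m‖ + P := by
    have e : chainFlux ϱ a b w T (ψ γ) m = colFlux ϱ a b w T ψ γ m - colPlanar ϱ a b w T ψ γ m := by rw [hcf m, add_sub_cancel_right]
    rw [e]
    exact (norm_sub_le _ _).trans (by linarith [hP m hm])
  have h3 : ∑ k ∈ Icc lo hi, ‖colFlux ϱ a b w T ψ γ k‖ ≤ (∑ k ∈ Icc lo hi, ‖chainFlux ϱ a b w T (ψ γ) k‖) + #(Icc lo hi) * P := by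
    have h : ∀ k ∈ Icc lo hi, ‖colFlux ϱ a b w T ψ γ k‖ ≤ ‖chainFlux ϱ a b w T (ψ γ) k‖ + P := fun k hk => by
      rw [hcf k]
      exact (norm_add_le _ _).trans (by linarith [hP k hk])
    have := sum_le_sum h
    rwa [sum_add_distrib, sum_const, nsmul_eq_mul] at this
  have key : (#(Icc lo hi) : ℝ) * ‖chainFlux ϱ a b w T (ψ γ) m‖ ≤ (∑ k ∈ Icc lo hi, ‖chainFlux ϱ a b w T (ψ γ) k‖) +
      #(Icc lo hi) * (2 * P + ∑ k ∈ Icc lo hi, ‖colFlux ϱ a b w T ψ γ k - colFlux ϱ a b w T ψ γ (k - 1)‖) := by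
    nlinarith [mul_le_mul_of_nonneg_left h2 hN.le]
  calc ‖chainFlux ϱ a b w T (ψ γ) m‖ = (#(Icc lo hi) : ℝ)⁻¹ * ((#(Icc lo hi) : ℝ) * ‖chainFlux ϱ a b w T (ψ γ) m‖) := by
        rw [inv_mul_cancel_left₀ hN.ne']
    _ ≤ (#(Icc lo hi) : ℝ)⁻¹ * ((∑ k ∈ Icc lo hi, ‖chainFlux ϱ a b w T (ψ γ) k‖) +
          #(Icc lo hi) * (2 * P + ∑ k ∈ Icc lo hi, ‖colFlux ϱ a b w T ψ γ k - colFlux ϱ a b w T ψ γ (k - 1)‖)) :=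
        mul_le_mul_of_nonneg_left key (inv_nonneg.mpr hN.le)
    _ = _ := by rw [mul_add, inv_mul_cancel_left₀ hN.ne', add_assoc]

/-! ### WH.3  The column master inequality -/

/-- ★★★ THE COLUMN MASTER INEQUALITY: with `W = [k₀ − R, k₀ + R]`, `r' = ⌊ϱ/c⌋`, `T_F ⊇` the `(r'+1)`-bands of `W`, `‖colPlanar‖ ≤ P` on `W` and the
increments bounded by `D` on the collar `[k₀ − R − r', k₀ + R + r'] \ W`,
`‖ψ γ (k₀+1) − ψ γ k₀‖ ≤ modeConst·((#W)⁻¹·Σ_W ‖chainFlux T_F (ψ γ)‖ + 2·P + Σ_W ‖colFlux(m) − colFlux(m−1)‖ + stabConst·(R+2)⁻²·D)`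
— WB `increment_le_local` on `T_B = [k₀ − R − r', k₀ + R + r']`, WH.1 and WH.2; uniform in `ϱ`, `T_F`, the window and the word. [this file, g58] -/
theorem increment_le_master (hc : 0 < c) (hL : IsLayeredCrystal c a b w) {κ₀ ε ϱ : ℝ} (hϱ : 0 ≤ ϱ) (hε : ε < 2 * κ₀)
    (hK : CoerciveZ (layeredKernel a b w) κ₀)
    (hT : ∀ φ : Cell 2 → ℤ → E3, HasFiniteSupport φ → Summable (tailFam ϱ a b w φ) ∧ ∑' x, tailFam ϱ a b w φ x ≤ ε * nnFormZ φ)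
    (ψ : Cell 2 → ℤ → E3) (γ : Cell 2) {k₀ : ℤ} {R : ℕ} {T_F : Finset ℤ}
    (hTF : ∀ m ∈ Icc (k₀ - R) (k₀ + R), Icc (m - ⌊ϱ / c⌋₊) (m + 1 + ⌊ϱ / c⌋₊) ⊆ T_F) {P D : ℝ} (hD0 : 0 ≤ D)
    (hP : ∀ m ∈ Icc (k₀ - R) (k₀ + R), ‖colPlanar ϱ a b w T_F ψ γ m‖ ≤ P)
    (hD : ∀ k ∈ Icc (k₀ - R - ⌊ϱ / c⌋₊) (k₀ + R + ⌊ϱ / c⌋₊) \ Icc (k₀ - R) (k₀ + R), ‖ψ γ (k + 1) - ψ γ k‖ ≤ D) :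
    ‖ψ γ (k₀ + 1) - ψ γ k₀‖ ≤ modeConst c (κ₀ - ε / 2) *
      ((#(Icc (k₀ - R) (k₀ + R)) : ℝ)⁻¹ * (∑ m ∈ Icc (k₀ - R) (k₀ + R), ‖chainFlux ϱ a b w T_F (ψ γ) m‖) + 2 * P +
        (∑ m ∈ Icc (k₀ - R) (k₀ + R), ‖colFlux ϱ a b w T_F ψ γ m - colFlux ϱ a b w T_F ψ γ (m - 1)‖) +
        stabConst c (κ₀ - ε / 2) * (((((R : ℕ) : ℝ)) + 2)⁻¹) ^ 2 * D) := by
  have hWT : Icc (k₀ - R) (k₀ + R) ⊆ Icc (k₀ - R - ⌊ϱ / c⌋₊) (k₀ + R + ⌊ϱ / c⌋₊) := Icc_subset_Icc (by omega) (by omega)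
  have hH : ∀ n ∈ Icc (k₀ - R) (k₀ + R), ‖blockApply (fluxBlock hc hL ϱ) (Icc (k₀ - R - ⌊ϱ / c⌋₊) (k₀ + R + ⌊ϱ / c⌋₊)) (fun k => ψ γ (k + 1) - ψ γ k) n‖ ≤
      (#(Icc (k₀ - R) (k₀ + R)) : ℝ)⁻¹ * (∑ m ∈ Icc (k₀ - R) (k₀ + R), ‖chainFlux ϱ a b w T_F (ψ γ) m‖) + 2 * P +
        ∑ m ∈ Icc (k₀ - R) (k₀ + R), ‖colFlux ϱ a b w T_F ψ γ m - colFlux ϱ a b w T_F ψ γ (m - 1)‖ := by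
    intro n hn
    have hn' := mem_Icc.mp hn
    rw [blockApply_fluxBlock_eq_chainFlux hc hL (ψ γ) (Icc_subset_Icc (by omega) (by omega)) (hTF n hn)]
    exact chainFlux_window_bound hc hL ϱ T_F ψ γ hn hP
  exact increment_le_local hc hL hϱ hε hK hT hWT (fun k => ψ γ (k + 1) - ψ γ k) hD0 hH hD

-- `sq_add_four_le` ((x+y+z+u)² ≤ 4(x²+y²+z²+u²)) restates Literature `…MatomakiRadziwillThm3.sq_add_four_le` (gate dedup.landed at landing,
-- hand-2 g27): copy deleted, inlined at its one use as a local `have`; all other statements untouched.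

/-- ★★ THE COLUMN MASTER INEQUALITY, SQUARED (Cauchy–Schwarz in the window): under the hypotheses of `increment_le_master`,
`‖ψ γ (k₀+1) − ψ γ k₀‖² ≤ 4·modeConst²·((#W)⁻¹·Σ_W ‖chainFlux T_F (ψ γ)‖² + 4·P² + #W·Σ_W ‖colFlux(m) − colFlux(m−1)‖² + stabConst²·(R+2)⁻⁴·D²)` —
the form step (SG) sums over the columns of a planar box. [this file, g58] -/
theorem increment_sq_le_master (hc : 0 < c) (hL : IsLayeredCrystal c a b w) {κ₀ ε ϱ : ℝ} (hϱ : 0 ≤ ϱ) (hε : ε < 2 * κ₀)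
    (hK : CoerciveZ (layeredKernel a b w) κ₀)
    (hT : ∀ φ : Cell 2 → ℤ → E3, HasFiniteSupport φ → Summable (tailFam ϱ a b w φ) ∧ ∑' x, tailFam ϱ a b w φ x ≤ ε * nnFormZ φ)
    (ψ : Cell 2 → ℤ → E3) (γ : Cell 2) {k₀ : ℤ} {R : ℕ} {T_F : Finset ℤ}
    (hTF : ∀ m ∈ Icc (k₀ - R) (k₀ + R), Icc (m - ⌊ϱ / c⌋₊) (m + 1 + ⌊ϱ / c⌋₊) ⊆ T_F) {P D : ℝ} (hP0 : 0 ≤ P) (hD0 : 0 ≤ D)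
    (hP : ∀ m ∈ Icc (k₀ - R) (k₀ + R), ‖colPlanar ϱ a b w T_F ψ γ m‖ ≤ P)
    (hD : ∀ k ∈ Icc (k₀ - R - ⌊ϱ / c⌋₊) (k₀ + R + ⌊ϱ / c⌋₊) \ Icc (k₀ - R) (k₀ + R), ‖ψ γ (k + 1) - ψ γ k‖ ≤ D) :
    ‖ψ γ (k₀ + 1) - ψ γ k₀‖ ^ 2 ≤ 4 * modeConst c (κ₀ - ε / 2) ^ 2 *
      ((#(Icc (k₀ - R) (k₀ + R)) : ℝ)⁻¹ * (∑ m ∈ Icc (k₀ - R) (k₀ + R), ‖chainFlux ϱ a b w T_F (ψ γ) m‖ ^ 2) + 4 * P ^ 2 +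
        #(Icc (k₀ - R) (k₀ + R)) * (∑ m ∈ Icc (k₀ - R) (k₀ + R), ‖colFlux ϱ a b w T_F ψ γ m - colFlux ϱ a b w T_F ψ γ (m - 1)‖ ^ 2) +
        stabConst c (κ₀ - ε / 2) ^ 2 * ((((((R : ℕ) : ℝ)) + 2)⁻¹) ^ 2) ^ 2 * D ^ 2) := by
  have hδ : 0 < κ₀ - ε / 2 := by linarith
  have hM := modeConst_nonneg c hδ
  have hS := stabConst_nonneg hc (κ₀ - ε / 2)
  have h := increment_le_master hc hL hϱ hε hK hT ψ γ hTF hD0 hP hD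
  set N : ℝ := (#(Icc (k₀ - R) (k₀ + R)) : ℝ) with hNdef
  set A : ℝ := ∑ m ∈ Icc (k₀ - R) (k₀ + R), ‖chainFlux ϱ a b w T_F (ψ γ) m‖ with hAdef
  set A₂ : ℝ := ∑ m ∈ Icc (k₀ - R) (k₀ + R), ‖chainFlux ϱ a b w T_F (ψ γ) m‖ ^ 2 with hA₂def
  set V : ℝ := ∑ m ∈ Icc (k₀ - R) (k₀ + R), ‖colFlux ϱ a b w T_F ψ γ m - colFlux ϱ a b w T_F ψ γ (m - 1)‖ with hVdef
  set V₂ : ℝ := ∑ m ∈ Icc (k₀ - R) (k₀ + R), ‖colFlux ϱ a b w T_F ψ γ m - colFlux ϱ a b w T_F ψ γ (m - 1)‖ ^ 2 with hV₂def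
  set ρ : ℝ := (((((R : ℕ) : ℝ)) + 2)⁻¹) ^ 2 with hρdef
  have hN0 : 0 ≤ N := Nat.cast_nonneg _
  have hA0 : 0 ≤ A := sum_nonneg fun _ _ => norm_nonneg _
  have hV0 : 0 ≤ V := sum_nonneg fun _ _ => norm_nonneg _
  have hρ0 : 0 ≤ ρ := by positivity
  have hAcs : A ^ 2 ≤ N * A₂ := sq_sum_le_card_mul_sum_sq
  have hVcs : V ^ 2 ≤ N * V₂ := sq_sum_le_card_mul_sum_sq
  -- the window average squared: `((#W)⁻¹·A)² ≤ (#W)⁻¹·A₂`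
  have hAv : (N⁻¹ * A) ^ 2 ≤ N⁻¹ * A₂ := by
    rcases hN0.eq_or_lt with hN | hN
    · rw [← hN, inv_zero, zero_mul, zero_mul, zero_pow two_ne_zero]
    · rw [mul_pow, sq, mul_assoc]
      refine mul_le_mul_of_nonneg_left ?_ (inv_nonneg.mpr hN.le)
      rw [inv_mul_le_iff₀ hN]
      exact hAcs
  have hx0 : 0 ≤ N⁻¹ * A + 2 * P + V + stabConst c (κ₀ - ε / 2) * ρ * D := by positivity
  have h0 : 0 ≤ ‖ψ γ (k₀ + 1) - ψ γ k₀‖ := norm_nonneg _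
  calc ‖ψ γ (k₀ + 1) - ψ γ k₀‖ ^ 2 ≤ (modeConst c (κ₀ - ε / 2) * (N⁻¹ * A + 2 * P + V + stabConst c (κ₀ - ε / 2) * ρ * D)) ^ 2 :=
        pow_le_pow_left₀ h0 h 2
    _ ≤ modeConst c (κ₀ - ε / 2) ^ 2 * (4 * ((N⁻¹ * A) ^ 2 + (2 * P) ^ 2 + V ^ 2 + (stabConst c (κ₀ - ε / 2) * ρ * D) ^ 2)) := by
        rw [mul_pow]
        have sq_add_four_le : ∀ x y z u : ℝ, (x + y + z + u) ^ 2 ≤ 4 * (x ^ 2 + y ^ 2 + z ^ 2 + u ^ 2) := fun x y z u => by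
          nlinarith [sq_nonneg (x - y), sq_nonneg (x - z), sq_nonneg (x - u), sq_nonneg (y - z), sq_nonneg (y - u), sq_nonneg (z - u)]
        exact mul_le_mul_of_nonneg_left (sq_add_four_le _ _ _ _) (sq_nonneg _)
    _ ≤ modeConst c (κ₀ - ε / 2) ^ 2 * (4 * (N⁻¹ * A₂ + (2 * P) ^ 2 + N * V₂ + (stabConst c (κ₀ - ε / 2) * ρ * D) ^ 2)) := by
        gcongr
    _ = _ := by ring

/-! ### WH.4  The closed statement of this part -/

/-- The content of part WH as one closed proposition: the column master inequality. -/
def ColumnMasterShape : Prop :=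
  ∀ c : ℝ, 0 < c → ∀ (a b : E3) (w : ℤ → E3) (hL : IsLayeredCrystal c a b w), ∀ κ₀ ε ϱ : ℝ, 0 ≤ ϱ → ε < 2 * κ₀ →
    CoerciveZ (layeredKernel a b w) κ₀ →
    (∀ φ : Cell 2 → ℤ → E3, HasFiniteSupport φ → Summable (tailFam ϱ a b w φ) ∧ ∑' x, tailFam ϱ a b w φ x ≤ ε * nnFormZ φ) →
    ∀ (ψ : Cell 2 → ℤ → E3) (γ : Cell 2) (k₀ : ℤ) (R : ℕ) (T_F : Finset ℤ),
      (∀ m ∈ Icc (k₀ - R) (k₀ + R), Icc (m - ⌊ϱ / c⌋₊) (m + 1 + ⌊ϱ / c⌋₊) ⊆ T_F) → ∀ (P D : ℝ), 0 ≤ D →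
      (∀ m ∈ Icc (k₀ - R) (k₀ + R), ‖colPlanar ϱ a b w T_F ψ γ m‖ ≤ P) →
      (∀ k ∈ Icc (k₀ - R - ⌊ϱ / c⌋₊) (k₀ + R + ⌊ϱ / c⌋₊) \ Icc (k₀ - R) (k₀ + R), ‖ψ γ (k + 1) - ψ γ k‖ ≤ D) →
      ‖ψ γ (k₀ + 1) - ψ γ k₀‖ ≤ modeConst c (κ₀ - ε / 2) *
        ((#(Icc (k₀ - R) (k₀ + R)) : ℝ)⁻¹ * (∑ m ∈ Icc (k₀ - R) (k₀ + R), ‖chainFlux ϱ a b w T_F (ψ γ) m‖) + 2 * P +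
          (∑ m ∈ Icc (k₀ - R) (k₀ + R), ‖colFlux ϱ a b w T_F ψ γ m - colFlux ϱ a b w T_F ψ γ (m - 1)‖) +
          stabConst c (κ₀ - ε / 2) * (((((R : ℕ) : ℝ)) + 2)⁻¹) ^ 2 * D)

/-- WH holds. [this file, g58] -/
theorem columnMasterShape_holds : ColumnMasterShape :=
  fun _c hc _a _b _w hL _κ₀ _ε _ϱ hϱ hε hK hT ψ γ _k₀ _R _T hTF _P _D hD0 hP hD => increment_le_master hc hL hϱ hε hK hT ψ γ hTF hD0 hP hD

end ColumnMaster

end Summit.AtomisticToContinuum.Crystallization.Theorems.ChartedZeroExcessLayeredLatticeLiouville
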